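import Summits.AtomisticToContinuum.HydrodynamicLimit.Theorems.TwoClocksTransferEntropyClockEquilibriumFamilyFrame
import Summits.AtomisticToContinuum.HydrodynamicLimit.Theorems.TwoClocksEquilibriumFastWindowLDStubHolderSplit
import HarnessLib

/-!
# Equilibrium family node from the pointwise kinetic node, layer 2: the property `Good`, convexity and closedness

Crux `Summit.AtomisticToContinuum.HydrodynamicLimit.Theses.TwoClocks.TransferEntropyClock` (stmt-AtomisticToContinuum-16625),
line `Sketch`, registered stub S3a `stub_equilibriumFamily : EquilibriumFamilyUpgrade`
(`= WindowUpgrade → TwoClocks.KineticWindowLDUniform → EquilibriumKineticLDFamily`): THE POINTWISE KINETIC DOCKING NODE IS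
SECRETLY FAMILY-UNIFORM AT GLOBAL EQUILIBRIUM — along one-parameter families of CONSTANT profiles `(a(s), θ(s), u(s))` and
x-independent weights at one fixed reduced density `σ`, the window-LD bound holds with a tilt radius `β₀` and, per `(β, ε)`,
thresholds `τ₀, N₀` UNIFORM in the family parameter. Proof files (lead prover-line-stmt-AtomisticToContinuum-16625-0):
`…EquilibriumFamilyFrame` (this chain's layer 1: exact frame reduction + Gaussian tail statics), `…EquilibriumFamilyStatics`
(layer 2: the property `Good`, midpoint convexity, closed radius super-level sets), `…EquilibriumFamilyBaire` (layer 3: the Banach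
space of admissible profiles, the Baire uniform-radius theorem, orthogonality transfer), `…EquilibriumFamily` (layer 4: the stub).

THIS FILE. At the unit frame `G_N(1, 0, 1)` and for a bounded continuous velocity PROFILE `f` (the fast functional being
`(1 + ‖v‖²) f(v)`), `Good σ Φ f` is the window-LD bound at tilt `1` at EVERY long window with ONE threshold in `N`
(`∀ ε ∃ τ₀ ∃ N₀ ∀ τ ≥ τ₀ ∀ N ≥ N₀`). It is midpoint-convex (`Good.midpoint`, Cauchy–Schwarz at a common window through the
landed `FastWindowRG.stub_holderSplit`) and its radius super-level sets `{f | ∀ |t| < c, Good (t • f)}` are CLOSED in the sup norm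
(`isClosed_goodRadius`: Hölder transfer with a slack depending only on `(t, c)` plus the static bound `vMoment_le_of_abs_le` for
`δ(1+‖v‖²)`-small perturbations, the index of the approximating sequence being chosen after `ε`). Also the isolated Hölder + tail
estimate `local_window_bound` of the compactness step of layer 4.
-/

noncomputable section

open MeasureTheory Filter Set Topology Function
open scoped ENNReal
open Literature.MathematicalPhysics.KineticTheory Literature.Analysis.FluidPDE
open Summit.AtomisticToContinuum.HydrodynamicLimit.Theorems.KineticWindowGronwallBoost
open Summit.AtomisticToContinuum.HydrodynamicLimit.Theorems.KineticWindowGronwallThermalScaling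
open Summit.AtomisticToContinuum.HydrodynamicLimit.Theorems.KineticWindowGronwallFrame
open Summit.AtomisticToContinuum.HydrodynamicLimit.Theorems.KineticWindowGronwallNegative

namespace Summit.AtomisticToContinuum.HydrodynamicLimit.Theorems.TransferEntropyClockFrame

variable {σ : ℝ} {N : ℕ}

/-! ## Static control of small quadratic-growth perturbations (unit temperature, no drift) -/

/-- **STATIC PERTURBATION BOUND.** Under the homogeneous law `G_N(a, 0, 1)`, a continuous velocity observable `H`
with `|H(v)| ≤ δ (1 + ‖v‖²)`, `0 ≤ δ ≤ 1/4`, has window exponential moment `≤ e^{7δ(N+1)}` at tilt `1`, EVERY window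
`τ > 0`, every `N` and every flow (Jensen in time + invariance, `lintegral_exp_windowSum_le_static`; Gaussian quadratic
moment, `lintegral_exp_quadratic_localGibbsLaw_le`). The quantitative closedness input of the Baire argument.
[folklore] -/
theorem vMoment_le_of_abs_le (σ a : ℝ) (N : ℕ) (Φ : TFlow σ N) {H : V3 → ℝ} (hH : Continuous H) {δ : ℝ}
    (hδ0 : 0 ≤ δ) (hδ : δ ≤ 1 / 4) (hHδ : ∀ v, |H v| ≤ δ * (1 + ‖v‖ ^ 2)) {τ : ℝ} (hτ : 0 < τ) :
    vMoment σ a 1 0 N Φ H 1 τ ≤ ENNReal.ofReal (Real.exp (7 * δ * ((N : ℝ) + 1))) := by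
  have hw : 0 < τ * ((N : ℝ) + 1) ^ (-(1 / 3 : ℝ)) := mul_pos hτ (Real.rpow_pos_of_pos (by positivity) _)
  have hF : Continuous fun y : T3 × V3 => H y.2 := hH.comp continuous_snd
  unfold vMoment
  -- Jensen in time + invariance
  refine (lintegral_exp_windowSum_le_static σ a 1 0 N Φ hF 1 hw).trans ?_
  -- pointwise: `exp(Σ H(vᵢ)) ≤ exp(δ(N+1)) exp(δ Σ ‖vᵢ‖²)`
  have hpt : ∀ z : Config (N + 1) (Fin 3) T3,
      ENNReal.ofReal (Real.exp (1 * ∑ i, H (z i).2)) ≤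
        ENNReal.ofReal (Real.exp (δ * ((N : ℝ) + 1))) * ENNReal.ofReal (Real.exp (δ * ∑ i, ‖(z i).2‖ ^ 2)) := by
    intro z
    rw [← ENNReal.ofReal_mul (Real.exp_nonneg _), ← Real.exp_add, one_mul]
    refine ENNReal.ofReal_le_ofReal (Real.exp_le_exp.2 ?_)
    calc ∑ i, H (z i).2 ≤ ∑ i, δ * (1 + ‖(z i).2‖ ^ 2) :=
          Finset.sum_le_sum fun i _ => (le_abs_self _).trans (hHδ _)
      _ = δ * ((N : ℝ) + 1) + δ * ∑ i, ‖(z i).2‖ ^ 2 := by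
          simp only [mul_add, mul_one, Finset.sum_add_distrib, Finset.sum_const, Finset.card_univ,
            Fintype.card_fin, nsmul_eq_mul, Finset.mul_sum]
          push_cast
          ring
  refine (lintegral_mono hpt).trans ?_
  rw [lintegral_const_mul' _ _ ENNReal.ofReal_ne_top]
  -- the Gaussian quadratic moment
  have hlam : δ * (1 : ℝ) < 1 / 2 := by linarith
  refine (mul_le_mul' le_rfl (KineticWindowGronwallQuadraticMoment.lintegral_exp_quadratic_localGibbsLaw_le σ a
    one_pos hlam N Φ)).trans ?_
  rw [mul_one, ← ENNReal.ofReal_mul (Real.exp_nonneg _)]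
  refine ENNReal.ofReal_le_ofReal ?_
  have hb : (1 - 2 * δ) ^ (-(3 / 2 : ℝ)) ≤ Real.exp (6 * δ) := one_sub_two_mul_rpow_le_exp hδ0 hδ
  have hb0 : 0 ≤ (1 - 2 * δ) ^ (-(3 / 2 : ℝ)) := Real.rpow_nonneg (by linarith) _
  calc Real.exp (δ * ((N : ℝ) + 1)) * ((1 - 2 * δ) ^ (-(3 / 2 : ℝ))) ^ (N + 1)
      ≤ Real.exp (δ * ((N : ℝ) + 1)) * (Real.exp (6 * δ)) ^ (N + 1) := by
        gcongr
    _ = Real.exp (7 * δ * ((N : ℝ) + 1)) := by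
        rw [← Real.exp_nat_mul, ← Real.exp_add]
        push_cast
        ring_nf


/-! ## Tilts and constants -/

/-- Pulling a constant out of the observable into the tilt: `M(c φ; β) = M(φ; β c)`. [folklore] -/
theorem vMoment_const_mul (σ a θ : ℝ) (u : V3) (N : ℕ) (Φ : TFlow σ N) (φ : V3 → ℝ) (c β τ : ℝ) :
    vMoment σ a θ u N Φ (fun v => c * φ v) β τ = vMoment σ a θ u N Φ φ (β * c) τ := by
  unfold vMoment
  refine lintegral_congr fun z => ?_
  congr 2
  simp only [intervalIntegral.integral_const_mul, Finset.mul_sum]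
  refine Finset.sum_congr rfl fun i _ => ?_
  ring

/-! ## The unit-frame property `Good` of a bounded continuous velocity profile -/

section UnitFrame

variable (σ : ℝ) (Φ : (N : ℕ) → TFlow σ N)

/-- **`Good σ Φ f`**: the weighted functional `v ↦ (1 + ‖v‖²) f(v)` of the bounded continuous profile `f` satisfies the
unit-frame window-LD bound at tilt `1` at EVERY long window with ONE threshold in `N` (strong shape):
`∀ ε ∃ τ₀ ∃ N₀ ∀ τ ≥ τ₀ ∀ N ≥ N₀,
M_N(1, 0, 1; (1+‖v‖²) f; 1; τ) ≤ e^{ε(N+1)}`. The property the Baire lemma is applied to. -/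
def Good (f : BoundedContinuousFunction V3 ℝ) : Prop :=
  ∀ ε : ℝ, 0 < ε → ∃ τ₀ : ℝ, 0 < τ₀ ∧ ∃ N₀ : ℕ, ∀ τ : ℝ, τ₀ ≤ τ → ∀ N : ℕ, N₀ ≤ N →
    vMoment σ 1 1 0 N (Φ N) (fun v => (1 + ‖v‖ ^ 2) * f v) 1 τ ≤ ENNReal.ofReal (Real.exp (ε * ((N : ℝ) + 1)))

variable {σ Φ}

/-- The weighted functional of `t • f` at tilt `1` is the weighted functional of `f` at tilt `t`. [folklore] -/
theorem vMoment_weight_smul (a θ : ℝ) (u : V3) (N : ℕ) (Ψ : TFlow σ N) (f : BoundedContinuousFunction V3 ℝ)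
    (t τ : ℝ) :
    vMoment σ a θ u N Ψ (fun v => (1 + ‖v‖ ^ 2) * (t • f) v) 1 τ =
      vMoment σ a θ u N Ψ (fun v => (1 + ‖v‖ ^ 2) * f v) t τ := by
  have h : (fun v : V3 => (1 + ‖v‖ ^ 2) * (t • f) v) = fun v => t * ((1 + ‖v‖ ^ 2) * f v) := by
    funext v
    simp only [BoundedContinuousFunction.coe_smul, smul_eq_mul]
    ring
  rw [h, vMoment_const_mul, one_mul]

/-- The weighted functional of a bounded continuous profile is continuous. [folklore] -/
theorem continuous_weight_mul (f : BoundedContinuousFunction V3 ℝ) :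
    Continuous fun y : T3 × V3 => (1 + ‖y.2‖ ^ 2) * f y.2 := by
  have hf : Continuous f := f.continuous
  fun_prop

/-- The weighted velocity profile is continuous. [folklore] -/
theorem continuous_weight_mul_vel (f : BoundedContinuousFunction V3 ℝ) :
    Continuous fun v : V3 => (1 + ‖v‖ ^ 2) * f v := by
  have hf : Continuous f := f.continuous
  fun_prop

/-- **Midpoint convexity of `Good`** (Cauchy–Schwarz at a common window, `FastWindowRG.stub_holderSplit` with weight
`1/2`). [folklore] -/
theorem Good.midpoint {f g : BoundedContinuousFunction V3 ℝ} (hf : Good σ Φ f) (hg : Good σ Φ g) :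
    Good σ Φ ((2 : ℝ)⁻¹ • (f + g)) := by
  intro ε hε
  obtain ⟨τ₁, hτ₁, N₁, h₁⟩ := hf ε hε
  obtain ⟨τ₂, hτ₂, N₂, h₂⟩ := hg ε hε
  refine ⟨max τ₁ τ₂, lt_max_of_lt_left hτ₁, max N₁ N₂, fun τ hτ N hN => ?_⟩
  have hA := h₁ τ ((le_max_left _ _).trans hτ) N ((le_max_left _ _).trans hN)
  have hB := h₂ τ ((le_max_right _ _).trans hτ) N ((le_max_right _ _).trans hN)
  have hτ0 : 0 < τ := hτ₁.trans_le ((le_max_left _ _).trans hτ)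
  have hw : 0 < τ * ((N : ℝ) + 1) ^ (-(1 / 3 : ℝ)) := mul_pos hτ0 (Real.rpow_pos_of_pos (by positivity) _)
  -- split the midpoint functional as `G + T`, `G = (weight·f)/2`, `T = (weight·g)/2`
  have hsplit : (fun v : V3 => (1 + ‖v‖ ^ 2) * ((2 : ℝ)⁻¹ • (f + g)) v) =
      fun v => (2 : ℝ)⁻¹ * ((1 + ‖v‖ ^ 2) * f v) + (2 : ℝ)⁻¹ * ((1 + ‖v‖ ^ 2) * g v) := by
    funext v
    simp only [BoundedContinuousFunction.coe_smul, BoundedContinuousFunction.coe_add, Pi.add_apply,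
      smul_eq_mul]
    ring
  have hG : Continuous fun y : T3 × V3 => (2 : ℝ)⁻¹ * ((1 + ‖y.2‖ ^ 2) * f y.2) :=
    continuous_const.mul (continuous_weight_mul f)
  have hT : Continuous fun y : T3 × V3 => (2 : ℝ)⁻¹ * ((1 + ‖y.2‖ ^ 2) * g y.2) :=
    continuous_const.mul (continuous_weight_mul g)
  have hH := FastWindowRG.stub_holderSplit σ 1 1 (0 : V3) N (Φ N) hG hT 1 (ϑ := 2⁻¹) (by norm_num) (by norm_num) hw
  -- identify the three moments
  have hL : vMoment σ 1 1 0 N (Φ N) (fun v => (1 + ‖v‖ ^ 2) * ((2 : ℝ)⁻¹ • (f + g)) v) 1 τ =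
      ∫⁻ z, ENNReal.ofReal (Real.exp (1 * ∑ i : Fin (N + 1),
        (τ * ((N : ℝ) + 1) ^ (-(1 / 3 : ℝ)))⁻¹ * ∫ r in (0 : ℝ)..(τ * ((N : ℝ) + 1) ^ (-(1 / 3 : ℝ))),
          ((2 : ℝ)⁻¹ * ((1 + ‖((Φ N).flow r z i).2‖ ^ 2) * f ((Φ N).flow r z i).2) +
            (2 : ℝ)⁻¹ * ((1 + ‖((Φ N).flow r z i).2‖ ^ 2) * g ((Φ N).flow r z i).2))))
        ∂(localGibbsLaw σ (fun _ => (1 : ℝ)) (fun _ => (0 : V3)) (fun _ => (1 : ℝ)) N (Φ N)) := by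
    unfold vMoment; rw [hsplit]
  have hF1 : (∫⁻ z, ENNReal.ofReal (Real.exp (1 / (1 - 2⁻¹) * ∑ i : Fin (N + 1),
        (τ * ((N : ℝ) + 1) ^ (-(1 / 3 : ℝ)))⁻¹ * ∫ r in (0 : ℝ)..(τ * ((N : ℝ) + 1) ^ (-(1 / 3 : ℝ))),
          (2 : ℝ)⁻¹ * ((1 + ‖((Φ N).flow r z i).2‖ ^ 2) * f ((Φ N).flow r z i).2)))
        ∂(localGibbsLaw σ (fun _ => (1 : ℝ)) (fun _ => (0 : V3)) (fun _ => (1 : ℝ)) N (Φ N))) =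
      vMoment σ 1 1 0 N (Φ N) (fun v => (1 + ‖v‖ ^ 2) * f v) 1 τ := by
    have h := vMoment_const_mul σ 1 1 0 N (Φ N) (fun v => (1 + ‖v‖ ^ 2) * f v) 2⁻¹ (1 / (1 - 2⁻¹)) τ
    unfold vMoment at h ⊢
    rw [h]; norm_num
  have hF2 : (∫⁻ z, ENNReal.ofReal (Real.exp (1 / 2⁻¹ * ∑ i : Fin (N + 1),
        (τ * ((N : ℝ) + 1) ^ (-(1 / 3 : ℝ)))⁻¹ * ∫ r in (0 : ℝ)..(τ * ((N : ℝ) + 1) ^ (-(1 / 3 : ℝ))),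
          (2 : ℝ)⁻¹ * ((1 + ‖((Φ N).flow r z i).2‖ ^ 2) * g ((Φ N).flow r z i).2)))
        ∂(localGibbsLaw σ (fun _ => (1 : ℝ)) (fun _ => (0 : V3)) (fun _ => (1 : ℝ)) N (Φ N))) =
      vMoment σ 1 1 0 N (Φ N) (fun v => (1 + ‖v‖ ^ 2) * g v) 1 τ := by
    have h := vMoment_const_mul σ 1 1 0 N (Φ N) (fun v => (1 + ‖v‖ ^ 2) * g v) 2⁻¹ (1 / 2⁻¹) τ
    unfold vMoment at h ⊢
    rw [h]; norm_num
  rw [hL]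
  refine hH.trans ?_
  rw [hF1, hF2]
  calc vMoment σ 1 1 0 N (Φ N) (fun v => (1 + ‖v‖ ^ 2) * f v) 1 τ ^ (1 - 2⁻¹ : ℝ) *
        vMoment σ 1 1 0 N (Φ N) (fun v => (1 + ‖v‖ ^ 2) * g v) 1 τ ^ (2⁻¹ : ℝ)
      ≤ ENNReal.ofReal (Real.exp (ε * ((N : ℝ) + 1))) ^ (1 - 2⁻¹ : ℝ) *
          ENNReal.ofReal (Real.exp (ε * ((N : ℝ) + 1))) ^ (2⁻¹ : ℝ) :=
        mul_le_mul' (ENNReal.rpow_le_rpow hA (by norm_num)) (ENNReal.rpow_le_rpow hB (by norm_num))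
    _ = ENNReal.ofReal (Real.exp (ε * ((N : ℝ) + 1))) := by
        rw [← ENNReal.rpow_add_of_nonneg _ _ (by norm_num) (by norm_num)]
        norm_num

end UnitFrame


section Closed

variable {σ : ℝ} {Φ : (N : ℕ) → TFlow σ N}

/-- **Hölder transfer between two velocity observables** at a common window (unit frame):
`M(φ + ψ; 1) ≤ M(φ; 1/(1−ϑ))^{1−ϑ} · M(ψ; 1/ϑ)^ϑ` (`FastWindowRG.stub_holderSplit`). [folklore] -/
theorem vMoment_add_le (N : ℕ) (Ψ : TFlow σ N) {φ ψ : V3 → ℝ} (hφ : Continuous φ) (hψ : Continuous ψ)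
    {ϑ : ℝ} (hϑ0 : 0 < ϑ) (hϑ1 : ϑ < 1) {τ : ℝ} (hτ : 0 < τ) :
    vMoment σ 1 1 0 N Ψ (fun v => φ v + ψ v) 1 τ ≤
      vMoment σ 1 1 0 N Ψ φ (1 / (1 - ϑ)) τ ^ (1 - ϑ) * vMoment σ 1 1 0 N Ψ ψ (1 / ϑ) τ ^ ϑ := by
  have hw : 0 < τ * ((N : ℝ) + 1) ^ (-(1 / 3 : ℝ)) := mul_pos hτ (Real.rpow_pos_of_pos (by positivity) _)
  have h := FastWindowRG.stub_holderSplit σ 1 1 (0 : V3) N Ψ (G := fun y : T3 × V3 => φ y.2)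
    (T := fun y : T3 × V3 => ψ y.2) (hφ.comp continuous_snd) (hψ.comp continuous_snd) 1 hϑ0 hϑ1 hw
  unfold vMoment
  simpa only [one_div] using h

/-- **Perturbation in sup norm (Hölder + statics).** For profiles `f, g`, a tilt `t`, a slack `0 < ϑ < 1` with
`δ := dist g f · |t|/ϑ ≤ 1/4`, every window `τ > 0` and every `N`:
`M((1+‖v‖²) f; t) ≤ M((1+‖v‖²) g; t/(1−ϑ))^{1−ϑ} · e^{7δϑ(N+1)}`. [folklore] -/
theorem vMoment_weight_le_of_dist (N : ℕ) (Ψ : TFlow σ N) (f g : BoundedContinuousFunction V3 ℝ) (t : ℝ)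
    {ϑ : ℝ} (hϑ0 : 0 < ϑ) (hϑ1 : ϑ < 1) (hδ4 : dist g f * (|t| / ϑ) ≤ 1 / 4) {τ : ℝ} (hτ : 0 < τ) :
    vMoment σ 1 1 0 N Ψ (fun v => (1 + ‖v‖ ^ 2) * f v) t τ ≤
      vMoment σ 1 1 0 N Ψ (fun v => (1 + ‖v‖ ^ 2) * g v) (t / (1 - ϑ)) τ ^ (1 - ϑ) *
        ENNReal.ofReal (Real.exp (7 * (dist g f * (|t| / ϑ)) * ((N : ℝ) + 1))) ^ ϑ := by
  have hδ0 : 0 ≤ dist g f * (|t| / ϑ) := by positivity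
  -- the static factor
  have hHc : Continuous fun v : V3 => (t / ϑ) * ((1 + ‖v‖ ^ 2) * (f - g) v) :=
    continuous_const.mul (continuous_weight_mul_vel (f - g))
  have hHδ : ∀ v, |(t / ϑ) * ((1 + ‖v‖ ^ 2) * (f - g) v)| ≤ dist g f * (|t| / ϑ) * (1 + ‖v‖ ^ 2) := by
    intro v
    have hfv : |(f - g) v| ≤ dist g f := by
      rw [dist_comm, dist_eq_norm]
      exact (f - g).norm_coe_le_norm v
    have hw0 : 0 ≤ 1 + ‖v‖ ^ 2 := by positivity
    rw [abs_mul, abs_mul, abs_div, abs_of_pos hϑ0, abs_of_nonneg hw0]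
    calc |t| / ϑ * ((1 + ‖v‖ ^ 2) * |(f - g) v|) ≤ |t| / ϑ * ((1 + ‖v‖ ^ 2) * dist g f) := by gcongr
      _ = dist g f * (|t| / ϑ) * (1 + ‖v‖ ^ 2) := by ring
  have hB := vMoment_le_of_abs_le σ 1 N Ψ hHc hδ0 hδ4 hHδ hτ
  -- Hölder
  have hφc : Continuous fun v : V3 => t * ((1 + ‖v‖ ^ 2) * g v) :=
    continuous_const.mul (continuous_weight_mul_vel g)
  have hψc : Continuous fun v : V3 => t * ((1 + ‖v‖ ^ 2) * (f - g) v) :=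
    continuous_const.mul (continuous_weight_mul_vel (f - g))
  have h := vMoment_add_le N Ψ hφc hψc hϑ0 hϑ1 hτ
  have e1 : (fun v : V3 => t * ((1 + ‖v‖ ^ 2) * g v) + t * ((1 + ‖v‖ ^ 2) * (f - g) v)) =
      fun v => t * ((1 + ‖v‖ ^ 2) * f v) := by
    funext v; simp only [BoundedContinuousFunction.coe_sub, Pi.sub_apply]; ring
  rw [e1, vMoment_const_mul, one_mul, vMoment_const_mul, vMoment_const_mul] at h
  have e2 : 1 / (1 - ϑ) * t = t / (1 - ϑ) := by ring
  have e3 : (1 / ϑ * t) = 1 * (t / ϑ) := by ring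
  rw [e2, e3] at h
  rw [vMoment_const_mul] at hB
  exact h.trans (mul_le_mul' le_rfl (ENNReal.rpow_le_rpow hB hϑ0.le))

/-- **Closedness of the radius super-level sets of `Good`** (sup norm): if `f_k → f` and every `f_k` is good at all
tilts `|t| < c`, so is `f` — `vMoment_weight_le_of_dist` with a slack `ϑ` depending only on `(t, c)` and `k`
chosen after `ε`. [folklore] -/
theorem isClosed_goodRadius (c : ℝ) :
    IsClosed {f : BoundedContinuousFunction V3 ℝ | ∀ t : ℝ, |t| < c → Good σ Φ (t • f)} := by
  refine IsSeqClosed.isClosed fun fk f hk hlim => ?_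
  intro t ht ε hε
  have hc : 0 < c := (abs_nonneg t).trans_lt ht
  -- the slack
  obtain ⟨ϑ, hϑ0, hϑ1, ht'c⟩ : ∃ ϑ : ℝ, 0 < ϑ ∧ ϑ < 1 ∧ |t / (1 - ϑ)| < c := by
    refine ⟨(c - |t|) / (2 * c), div_pos (by linarith) (by positivity), ?_, ?_⟩
    · rw [div_lt_one (by positivity)]; linarith [abs_nonneg t]
    · have h1 : 1 - (c - |t|) / (2 * c) = (c + |t|) / (2 * c) := by field_simp; ring
      have hp : 0 < (c + |t|) / (2 * c) := by positivity
      rw [h1, abs_div, abs_of_pos hp, div_lt_iff₀ hp]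
      have : c * ((c + |t|) / (2 * c)) = (c + |t|) / 2 := by field_simp
      rw [this]; linarith
  have h1ϑ : 0 < 1 - ϑ := by linarith
  -- choose `k` (after `ε`)
  set η : ℝ := min (1 / 4) (ε / 14) with hη
  have hη0 : 0 < η := lt_min (by norm_num) (by positivity)
  obtain ⟨k, hk'⟩ : ∃ k, dist (fk k) f * (|t| / ϑ) ≤ η := by
    have hpos : 0 < η * ϑ / (|t| + 1) := by positivity
    obtain ⟨K, hK⟩ := Metric.tendsto_atTop.1 (tendsto_iff_dist_tendsto_zero.1 hlim) _ hpos
    have hd := hK K le_rfl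
    rw [Real.dist_eq, sub_zero, abs_of_nonneg dist_nonneg] at hd
    refine ⟨K, ?_⟩
    calc dist (fk K) f * (|t| / ϑ) ≤ η * ϑ / (|t| + 1) * (|t| / ϑ) :=
          mul_le_mul_of_nonneg_right hd.le (by positivity)
      _ = η * (|t| / (|t| + 1)) := by field_simp
      _ ≤ η * 1 := by
          gcongr
          rw [div_le_one (by positivity)]; linarith
      _ = η := mul_one _
  have hδ4 : dist (fk k) f * (|t| / ϑ) ≤ 1 / 4 := hk'.trans (min_le_left _ _)
  have hδε : dist (fk k) f * (|t| / ϑ) ≤ ε / 14 := hk'.trans (min_le_right _ _)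
  -- thresholds from `Good ((t/(1-ϑ)) • fk k)` at `ε / 2`
  obtain ⟨τ₀, hτ₀, N₀, hgood⟩ := hk k (t / (1 - ϑ)) ht'c (ε / 2) (half_pos hε)
  refine ⟨τ₀, hτ₀, N₀, fun τ hτ N hN => ?_⟩
  have hτpos : 0 < τ := hτ₀.trans_le hτ
  have hA := hgood τ hτ N hN
  rw [vMoment_weight_smul] at hA ⊢
  refine (vMoment_weight_le_of_dist N (Φ N) f (fk k) t hϑ0 hϑ1 hδ4 hτpos).trans ?_
  calc vMoment σ 1 1 0 N (Φ N) (fun v => (1 + ‖v‖ ^ 2) * fk k v) (t / (1 - ϑ)) τ ^ (1 - ϑ) *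
        ENNReal.ofReal (Real.exp (7 * (dist (fk k) f * (|t| / ϑ)) * ((N : ℝ) + 1))) ^ ϑ
      ≤ ENNReal.ofReal (Real.exp (ε / 2 * ((N : ℝ) + 1))) ^ (1 - ϑ) *
          ENNReal.ofReal (Real.exp (7 * (dist (fk k) f * (|t| / ϑ)) * ((N : ℝ) + 1))) ^ ϑ :=
        mul_le_mul' (ENNReal.rpow_le_rpow hA h1ϑ.le) le_rfl
    _ ≤ ENNReal.ofReal (Real.exp (ε * ((N : ℝ) + 1))) := by
        rw [ENNReal.ofReal_rpow_of_pos (Real.exp_pos _), ENNReal.ofReal_rpow_of_pos (Real.exp_pos _),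
          ← Real.exp_mul, ← Real.exp_mul, ← ENNReal.ofReal_mul (Real.exp_nonneg _), ← Real.exp_add]
        refine ENNReal.ofReal_le_ofReal (Real.exp_le_exp.2 ?_)
        have hN1 : (0 : ℝ) ≤ (N : ℝ) + 1 := by positivity
        have h1 : ε / 2 * ((N : ℝ) + 1) * (1 - ϑ) ≤ ε / 2 * ((N : ℝ) + 1) :=
          mul_le_of_le_one_right (by positivity) (by linarith)
        have h2 : 7 * (dist (fk k) f * (|t| / ϑ)) * ((N : ℝ) + 1) * ϑ ≤ ε / 2 * ((N : ℝ) + 1) := by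
          have h3 : 7 * (dist (fk k) f * (|t| / ϑ)) * ((N : ℝ) + 1) * ϑ ≤
              7 * (dist (fk k) f * (|t| / ϑ)) * ((N : ℝ) + 1) * 1 := by gcongr
          nlinarith
        linarith

end Closed


/-! ## The local window bound of the compactness step -/

section Local

/-- **The local window bound (Hölder + tail statics), isolated.** At a common unit-frame window `τ'`: if the reference
functional `Ψ₀ = (1+‖v‖²) f₀` satisfies the bound at tilt `2β`, and `Ψ` is `δ'`-close to `Ψ₀` on `‖v‖ ≤ L` and
`2R(1+‖v‖²)`-close everywhere, with `2|β|δ' ≤ 1/8`, `26|β|δ' ≤ ε/4` and a Gaussian tail `≤ ε/4` beyond `L`,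
then `Ψ` satisfies the bound at tilt `β`. [folklore] -/
theorem local_window_bound {σ : ℝ} (hσ2 : σ ≤ 1 / 2) (N : ℕ) (Ψ' : TFlow σ N) {Ψ Ψ₀ : V3 → ℝ} (hΨ : Continuous Ψ)
    (hΨ₀ : Continuous Ψ₀) {β δ' R L ε τ' : ℝ} (hτ' : 0 < τ') (hε : 0 < ε) (hδ'0 : 0 < δ')
    (hδ1 : 2 * |β| * δ' ≤ 1 / 8) (hδ2 : 13 * (2 * |β| * δ') ≤ ε / 4)
    (hnear : ∀ w : V3, ‖w‖ ≤ L → |Ψ w - Ψ₀ w| ≤ δ') (hfar : ∀ w : V3, |Ψ w - Ψ₀ w| ≤ 2 * R * (1 + ‖w‖ ^ 2))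
    (hL : ∫⁻ v in {v : V3 | L < ‖v‖}, ENNReal.ofReal (Real.exp (4 * |β| * R * (1 + ‖v‖ ^ 2))) ∂gaussMeasure (0 : V3) 1 ≤
      ENNReal.ofReal (ε / 4))
    (hA : vMoment σ 1 1 0 N Ψ' Ψ₀ (2 * β) τ' ≤ ENNReal.ofReal (Real.exp (ε * ((N : ℝ) + 1)))) :
    vMoment σ 1 1 0 N Ψ' Ψ β τ' ≤ ENNReal.ofReal (Real.exp (ε * ((N : ℝ) + 1))) := by
  -- Hölder split at the common window
  have hφc : Continuous fun w : V3 => β * Ψ₀ w := continuous_const.mul hΨ₀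
  have hψc : Continuous fun w : V3 => β * (Ψ w - Ψ₀ w) := continuous_const.mul (hΨ.sub hΨ₀)
  have hH := vMoment_add_le N Ψ' hφc hψc (ϑ := 2⁻¹) (by norm_num) (by norm_num) hτ'
  have e1 : (fun w : V3 => β * Ψ₀ w + β * (Ψ w - Ψ₀ w)) = fun w => β * Ψ w := by funext w; ring
  rw [e1, vMoment_const_mul, one_mul, vMoment_const_mul, vMoment_const_mul] at hH
  rw [show (1 : ℝ) / (1 - 2⁻¹) * β = 2 * β by norm_num, show (1 : ℝ) / 2⁻¹ * β = 2 * β by norm_num] at hH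
  -- the tail static bound for the perturbation
  have hb2 : 0 ≤ 2 * |β| := mul_nonneg zero_le_two (abs_nonneg β)
  have habs : ∀ w : V3, |(2 * β) * (Ψ w - Ψ₀ w)| = 2 * |β| * |Ψ w - Ψ₀ w| := fun w => by
    rw [abs_mul, abs_mul, abs_two]
  have hHc : Continuous fun w : V3 => (2 * β) * (Ψ w - Ψ₀ w) := continuous_const.mul (hΨ.sub hΨ₀)
  have hHδ : ∀ w : V3, ‖w‖ ≤ L → |(2 * β) * (Ψ w - Ψ₀ w)| ≤ (2 * |β| * δ') * (1 + ‖w‖ ^ 2) := by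
    intro w hw
    have hw2 : (1 : ℝ) ≤ 1 + ‖w‖ ^ 2 := le_add_of_nonneg_right (sq_nonneg _)
    rw [habs w]
    calc 2 * |β| * |Ψ w - Ψ₀ w| ≤ 2 * |β| * δ' := mul_le_mul_of_nonneg_left (hnear w hw) hb2
      _ = 2 * |β| * δ' * 1 := (mul_one _).symm
      _ ≤ 2 * |β| * δ' * (1 + ‖w‖ ^ 2) := mul_le_mul_of_nonneg_left hw2 (mul_nonneg hb2 hδ'0.le)
  have hHK : ∀ w : V3, |(2 * β) * (Ψ w - Ψ₀ w)| ≤ (4 * |β| * R) * (1 + ‖w‖ ^ 2) := by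
    intro w
    rw [habs w]
    calc 2 * |β| * |Ψ w - Ψ₀ w| ≤ 2 * |β| * (2 * R * (1 + ‖w‖ ^ 2)) := mul_le_mul_of_nonneg_left (hfar w) hb2
      _ = 4 * |β| * R * (1 + ‖w‖ ^ 2) := by ring
  have hB := vMoment_le_of_abs_le_tail σ one_pos hσ2 N Ψ' hHc (mul_nonneg hb2 hδ'0.le) hδ1 (by positivity)
    hHδ hHK hL hτ'
  rw [vMoment_const_mul, one_mul] at hB
  refine hH.trans ?_
  calc vMoment σ 1 1 0 N Ψ' Ψ₀ (2 * β) τ' ^ (1 - 2⁻¹ : ℝ) *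
        vMoment σ 1 1 0 N Ψ' (fun w => Ψ w - Ψ₀ w) (2 * β) τ' ^ (2⁻¹ : ℝ)
      ≤ ENNReal.ofReal (Real.exp (ε * ((N : ℝ) + 1))) ^ (1 - 2⁻¹ : ℝ) *
          ENNReal.ofReal (Real.exp ((13 * (2 * |β| * δ') + ε / 4) * ((N : ℝ) + 1))) ^ (2⁻¹ : ℝ) :=
        mul_le_mul' (ENNReal.rpow_le_rpow hA (by norm_num)) (ENNReal.rpow_le_rpow hB (by norm_num))
    _ ≤ ENNReal.ofReal (Real.exp (ε * ((N : ℝ) + 1))) := by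
        rw [ENNReal.ofReal_rpow_of_pos (Real.exp_pos _), ENNReal.ofReal_rpow_of_pos (Real.exp_pos _),
          ← Real.exp_mul, ← Real.exp_mul, ← ENNReal.ofReal_mul (Real.exp_nonneg _), ← Real.exp_add]
        refine ENNReal.ofReal_le_ofReal (Real.exp_le_exp.2 ?_)
        have hN1 : (0 : ℝ) ≤ (N : ℝ) + 1 := by positivity
        nlinarith [mul_nonneg hε.le hN1]

/-- `σ³ ≤ 1/16` forces `σ < 1/2`. [folklore] -/
theorem lt_half_of_cube_le {σ : ℝ} (h : σ ^ 3 ≤ 1 / 16) : σ < 2⁻¹ := by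
  by_contra hc
  push Not at hc
  have : (2⁻¹ : ℝ) ^ 3 ≤ σ ^ 3 := pow_le_pow_left₀ (by norm_num) hc 3
  norm_num at this
  linarith

end Local

end Summit.AtomisticToContinuum.HydrodynamicLimit.Theorems.TransferEntropyClockFrame

end
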